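import Summits.Ventures.PercRepro.GenQRankStep
import Summits.Ventures.PercRepro.GenQCoreChain

/-!
# PercRepro — THE RANK-STEP BOUNDS: explicit per-flat constants at every rank, and the rank-`5` rows (night-4, gen 7)

Iterating the rank-step recursion of `GenQRankStep` from `N_{j,j} ≤ C(|X|, j)` gives, on a simple matroid with the size
chain `f` (`1 ≤ j < q`), `N_{j,k} ≤ C(|X|, j)·∏_{i=j}^{k−1} (f(j) − i)/(i + 3 − j)` (`card_rkSets_le_prod`).  The
`k`-subsets of a subset `X` of a rank-`r` flat are partitioned by their rank `0 … r` (`choose_eq_sum_card_rkSets`), the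
rank-`0` ones vanish for `k > f(0)` (`card_rkSets_zero_eq_zero`), so the rank-`r` `k`-subsets number at least
`C(|X|, k) − Σ_{1 ≤ j < r} C(|X|, j)·∏_{i=j}^{k−1} (f(j) − i)/(i + 3 − j)` (**`card_rkSets_top_ge`**) — explicit
per-flat constants for the `(S6r)` / `(Rtb)` templates of `GenQFlatRows` at EVERY rank.  On the core at rank `5`
(`fCore = 3, 3, 3, 6, 10, 21`): **`two_mul_choose_five_le`**: `2·C(s, 5) ≤ 2·N_{5,5} + 4·C(s, 4) + C(s, 3)` and
**`twenty_mul_choose_six_le`**: `20·C(s, 6) ≤ 20·N_{5,6} + 50·C(s, 4) + 2·C(s, 3)` for `X ⊆ F ∈ flatsQ M 5` — the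
generic halves of the rank-`5` rows of record (sheet §62 (h); within ≈ 10 % of the exact rank-`4` knapsacks at `s ≥ 9`).
Imports `GenQRankStep`, `GenQCoreChain`.
-/
namespace PercRepro.Night4

open Finset ThmH SixFour GenQ PerFlat Star NightThree

variable {α : Type} [DecidableEq α] {M : Matroid α} [M.Finite]

/-- **The iterated rank-step bound**: `N_{j,k} ≤ C(|X|, j)·∏_{i=j}^{k−1} (f(j) − i)/(i + 3 − j)` (`1 ≤ j < q`, `j ≤ k`). -/
theorem card_rkSets_le_prod (hs : Simple M) {q : ℕ} {f : ℕ → ℕ} (hf : SizeChain M q f) {X : Finset α}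
    (hX : X ⊆ gr M) {j : ℕ} (hj : 1 ≤ j) (hjq : j < q) :
    ∀ k, j ≤ k → ((rkSets M X j k).card : ℚ) ≤
      (X.card.choose j : ℚ) * ∏ i ∈ Finset.Ico j k, (((f j - i : ℕ) : ℚ) / ((i + 3 - j : ℕ) : ℚ)) := by
  intro k hk
  induction k, hk using Nat.le_induction with
  | base =>
    rw [Finset.Ico_self, Finset.prod_empty, mul_one]
    exact_mod_cast card_rkSets_le (M := M) X j j
  | succ k hjk ih =>
    have hstep := card_rkSets_succ_mul_le_of_sizeChain hs hf hX hj hjq hjk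
    have hpos : (0 : ℚ) < ((k + 3 - j : ℕ) : ℚ) := by
      have : 0 < k + 3 - j := by omega
      exact_mod_cast this
    have hstep' : ((k + 3 - j : ℕ) : ℚ) * ((rkSets M X j (k + 1)).card : ℚ) ≤
        ((f j - k : ℕ) : ℚ) * ((rkSets M X j k).card : ℚ) := by exact_mod_cast hstep
    have h1 : ((rkSets M X j (k + 1)).card : ℚ) ≤
        (((f j - k : ℕ) : ℚ) / ((k + 3 - j : ℕ) : ℚ)) * ((rkSets M X j k).card : ℚ) := by
      rw [div_mul_eq_mul_div, le_div_iff₀ hpos]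
      linarith
    rw [Finset.prod_Ico_succ_top hjk]
    have hnn : (0 : ℚ) ≤ ((f j - k : ℕ) : ℚ) / ((k + 3 - j : ℕ) : ℚ) := by positivity
    calc ((rkSets M X j (k + 1)).card : ℚ)
        ≤ (((f j - k : ℕ) : ℚ) / ((k + 3 - j : ℕ) : ℚ)) * ((rkSets M X j k).card : ℚ) := h1
      _ ≤ (((f j - k : ℕ) : ℚ) / ((k + 3 - j : ℕ) : ℚ)) *
          ((X.card.choose j : ℚ) * ∏ i ∈ Finset.Ico j k, (((f j - i : ℕ) : ℚ) / ((i + 3 - j : ℕ) : ℚ))) :=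
          mul_le_mul_of_nonneg_left ih hnn
      _ = (X.card.choose j : ℚ) * ((∏ i ∈ Finset.Ico j k, (((f j - i : ℕ) : ℚ) / ((i + 3 - j : ℕ) : ℚ))) *
          (((f j - k : ℕ) : ℚ) / ((k + 3 - j : ℕ) : ℚ))) := by ring

omit [DecidableEq α] in
/-- The `k`-subsets of a subset `X` of a rank-`r` flat, partitioned by rank: `C(|X|, k) = Σ_{j ≤ r} N_{j,k}`. -/
theorem choose_eq_sum_card_rkSets {X F : Finset α} {r : ℕ} (hF : F ∈ flatsQ M r) (hXF : X ⊆ F) (k : ℕ) :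
    X.card.choose k = ∑ j ∈ Finset.range (r + 1), (rkSets M X j k).card := by
  have hF' := mem_flatsQ.1 hF
  rw [← Finset.card_powersetCard]
  rw [Finset.card_eq_sum_card_fiberwise (s := X.powersetCard k) (t := Finset.range (r + 1))
    (f := fun A : Finset α => (M.eRk (A : Set α)).toNat) (fun A hA => by
      rw [Finset.mem_coe, Finset.mem_powersetCard] at hA
      rw [Finset.mem_coe, Finset.mem_range]
      have hle : M.eRk (A : Set α) ≤ (r : ℕ∞) := by
        rw [← hF'.2.2]
        exact M.eRk_mono (Finset.coe_subset.2 (hA.1.trans hXF))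
      obtain ⟨a, ha⟩ := exists_eRk_eq_nat (M := M) A
      show (M.eRk (A : Set α)).toNat < r + 1
      rw [ha] at hle ⊢
      have : a ≤ r := by exact_mod_cast hle
      simp only [ENat.toNat_coe]
      omega)]
  apply Finset.sum_congr rfl
  intro j _
  unfold rkSets
  apply congrArg Finset.card
  apply Finset.filter_congr
  intro A hA
  obtain ⟨a, ha⟩ := exists_eRk_eq_nat (M := M) A
  rw [ha]
  simp only [ENat.toNat_coe]
  constructor
  · intro h
    rw [h]
  · intro h
    exact_mod_cast h

omit [DecidableEq α] in
/-- No rank-`0` `k`-subset for `k > f(0)` (the size chain). -/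
theorem card_rkSets_zero_eq_zero {q : ℕ} {f : ℕ → ℕ} (hf : SizeChain M q f) (hq : 0 < q) {X : Finset α}
    (hX : X ⊆ gr M) {k : ℕ} (hk : f 0 < k) : (rkSets M X 0 k).card = 0 := by
  rw [Finset.card_eq_zero, Finset.eq_empty_iff_forall_notMem]
  intro A hA
  obtain ⟨hAX, hAc, hAr⟩ := mem_rkSets.1 hA
  have := hf A (hAX.trans hX) 0 hq (by rw [hAr])
  omega

/-- **The rank-`r` `k`-subsets of a subset of a rank-`r` flat**, from below: `N_{r,k} ≥ C(|X|, k) − Σ_{1 ≤ j < r} …`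
(`1 ≤ r < q`, `r ≤ k`, `f(0) < k`). -/
theorem card_rkSets_top_ge (hs : Simple M) {q : ℕ} {f : ℕ → ℕ} (hf : SizeChain M q f) {X F : Finset α}
    {r : ℕ} (hF : F ∈ flatsQ M r) (hXF : X ⊆ F) (hX : X ⊆ gr M) (hr : 1 ≤ r) (hrq : r < q) {k : ℕ}
    (hrk : r ≤ k) (hk0 : f 0 < k) :
    (X.card.choose k : ℚ) - ∑ j ∈ Finset.Ico 1 r,
      ((X.card.choose j : ℚ) * ∏ i ∈ Finset.Ico j k, (((f j - i : ℕ) : ℚ) / ((i + 3 - j : ℕ) : ℚ))) ≤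
      ((rkSets M X r k).card : ℚ) := by
  have hsum := choose_eq_sum_card_rkSets (M := M) hF hXF k
  have hsum' : (X.card.choose k : ℚ) = ∑ j ∈ Finset.range (r + 1), ((rkSets M X j k).card : ℚ) := by
    exact_mod_cast hsum
  rw [Finset.sum_range_succ, Finset.range_eq_Ico, ← Finset.sum_Ico_consecutive _ (Nat.zero_le 1) hr,
    Finset.sum_Ico_succ_top (Nat.zero_le 0), Finset.Ico_self, Finset.sum_empty, zero_add,
    card_rkSets_zero_eq_zero hf (by omega) hX hk0] at hsum'
  push_cast at hsum'
  have hle : ∑ j ∈ Finset.Ico 1 r, ((rkSets M X j k).card : ℚ) ≤ ∑ j ∈ Finset.Ico 1 r,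
      ((X.card.choose j : ℚ) * ∏ i ∈ Finset.Ico j k, (((f j - i : ℕ) : ℚ) / ((i + 3 - j : ℕ) : ℚ))) := by
    apply Finset.sum_le_sum
    intro j hj
    rw [Finset.mem_Ico] at hj
    exact card_rkSets_le_prod hs hf hX hj.1 (by omega) k (by omega)
  linarith

/-! ## The rank-`5` rows on the core -/

/-- **`2·C(s, 5) ≤ 2·N_{5,5} + 4·C(s, 4) + C(s, 3)`** for `X ⊆ F ∈ flatsQ M 5` on the core (`s = |X|`). -/
theorem two_mul_choose_five_le {p : ℕ} (hc : Core M p) (h10 : ∀ F ∈ flatsQ M 4, F.card ≤ 10) {X F : Finset α}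
    (hF : F ∈ flatsQ M 5) (hXF : X ⊆ F) :
    2 * X.card.choose 5 ≤ 2 * (rkSets M X 5 5).card + 4 * X.card.choose 4 + X.card.choose 3 := by
  have hX : X ⊆ gr M := hXF.trans (mem_flatsQ.1 hF).1
  have h := card_rkSets_top_ge (simple_of_core hc) (sizeChain_core hc h10 6) hF hXF hX (by norm_num)
    (by norm_num) (k := 5) (by norm_num) (by decide)
  simp only [Finset.sum_Ico_eq_sum_range, Finset.prod_Ico_eq_prod_range] at h
  norm_num [Finset.sum_range_succ, Finset.prod_range_succ, show fCore 4 = 10 from rfl, show fCore 1 = 3 from rfl,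
    show fCore 2 = 3 from rfl, show fCore 3 = 6 from rfl] at h
  have h' : (2 : ℚ) * X.card.choose 5 ≤ 2 * (rkSets M X 5 5).card + 4 * X.card.choose 4 + X.card.choose 3 := by
    linarith
  exact_mod_cast h'

/-- **`20·C(s, 6) ≤ 20·N_{5,6} + 50·C(s, 4) + 2·C(s, 3)`** for `X ⊆ F ∈ flatsQ M 5` on the core. -/
theorem twenty_mul_choose_six_le {p : ℕ} (hc : Core M p) (h10 : ∀ F ∈ flatsQ M 4, F.card ≤ 10) {X F : Finset α}
    (hF : F ∈ flatsQ M 5) (hXF : X ⊆ F) :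
    20 * X.card.choose 6 ≤ 20 * (rkSets M X 5 6).card + 50 * X.card.choose 4 + 2 * X.card.choose 3 := by
  have hX : X ⊆ gr M := hXF.trans (mem_flatsQ.1 hF).1
  have h := card_rkSets_top_ge (simple_of_core hc) (sizeChain_core hc h10 6) hF hXF hX (by norm_num)
    (by norm_num) (k := 6) (by norm_num) (by decide)
  simp only [Finset.sum_Ico_eq_sum_range, Finset.prod_Ico_eq_prod_range] at h
  norm_num [Finset.sum_range_succ, Finset.prod_range_succ, show fCore 4 = 10 from rfl, show fCore 1 = 3 from rfl,
    show fCore 2 = 3 from rfl, show fCore 3 = 6 from rfl] at h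
  have h' : (20 : ℚ) * X.card.choose 6 ≤ 20 * (rkSets M X 5 6).card + 50 * X.card.choose 4 + 2 * X.card.choose 3 := by
    linarith
  exact_mod_cast h'

end PercRepro.Night4
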